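import Literature.AlgebraicGeometry.Motives.TateAbelianFiniteAssemblyProofs
import Literature.AlgebraicGeometry.Motives.TateAbelianFiniteEndAlgebraProofs
import Literature.AlgebraicGeometry.Motives.TateAbelianFiniteEndProofs
import Literature.AlgebraicGeometry.Motives.TateAbelianFiniteLattice
import Literature.AlgebraicGeometry.Motives.AbelianVarietySimpleFactorsUnique
import Literature.AlgebraicGeometry.Motives.FaltingsAbelian
import Literature.NumberTheory.DiophantineGeometry.AVKernelHopf
import Literature.NumberTheory.DiophantineGeometry.AVIsogenyTateHoldsProofs
import HarnessLib

/-!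
# Isogeny invariance of Tate's conjecture for homomorphisms of abelian varieties

Theorems only (topic `AlgebraicGeometry/Motives`; no definition, no named fact, no instance).

For abelian varieties `A, B` over a field `K` and a prime `ℓ` invertible in `K`, the statement
«the Tate map `ℤ_ℓ ⊗_ℤ Hom_K(A, B) → Hom_{Γ_K}(T_ℓ A, T_ℓ B)` (`AbelianVariety.faltingsTateMap A B ℓ`)
is surjective» — equivalently bijective, injectivity being Mumford §19 Thm. 3
(`AbelianVariety.faltingsTateMap_injective_holds`) — depends only on the `K`-isogeny classes of
`A` and of `B`.  This is the first sentence of the proof of [Faltings 1983, §5 Satz 4] («For the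
proof one may extend the ground field, or replace `A` by an isogenous abelian variety», English
translation Cornell–Silverman ch. II §5 p. 21), in its ISOGENY half, kernel-checked for the
integral `Hom` statement [Fal83 §5 Kor. 1] = the tree's `faltings_tate_bijective A B ℓ`; the
finite-field theorem of Tate (Invent. Math. 2 (1966)) is reduced the same way (Kieffer 2024,
§1.2.4).

Proof.  Let `φ : B → B'` be an isogeny and `ψ : B' → B`, `0 < n`, with `φ ≫ ψ = [n]_B`,
`ψ ≫ φ = [n]_{B'}` (`IsIsogeny.exists_nsmul_inverse_holds`, Mumford §19 Remark p. 169).  For a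
`Γ_K`-equivariant `g' : T_ℓ A → T_ℓ B'` the composite `T_ℓ ψ ∘ g'` is equivariant into `T_ℓ B`,
hence (surjectivity for `(A, B)`) a `ℤ_ℓ`-combination of maps `T_ℓ f`, `f ∈ Hom_K(A, B)`; composing
with `T_ℓ φ` shows that `n • g' = T_ℓ φ ∘ T_ℓ ψ ∘ g'` is a `ℤ_ℓ`-combination of the
`T_ℓ (f ≫ φ)`.  The `ℤ_ℓ`-span of the `T_ℓ h`, `h ∈ Hom_K(A, B')`, is SATURATED in
`Hom_{ℤ_ℓ}(T_ℓ A, T_ℓ B')` (Tate 1966 §1 Lemma 1 / Milne 1986 Thm. 12.5, the tree's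
`saturated_span_tateModuleMap_of_divisible` with Milne's Lemma 12.6
`exists_eq_nsmul_of_forall_smul_eq_zero`), so `g'` itself lies in it
(`surjective_faltingsTateMap_of_forall_mem_span`).  Symmetrically on the left with `g' ∘ T_ℓ φ`
for an isogeny `φ : A → A'`.

* `comp_mem_span_tateModuleMap_of_mem_span`, `mem_span_tateModuleMap_comp_of_mem_span` — the
  `ℤ_ℓ`-span of the `T_ℓ f` is stable under `T_ℓ p ∘ –` and `– ∘ T_ℓ i`.
* `tateModuleMap_nsmul_id_apply` — `T_ℓ [n] x = n • x`.
* `mem_span_tateModuleMap_of_nsmul_mem` — saturation for a natural multiple `n • t`, `0 < n`.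
* `surjective_faltingsTateMap_of_isIsogeny_right/left`, `bijective_faltingsTateMap_of_isIsogeny_right/left`,
  `surjective/bijective_faltingsTateMap_of_isIsogenous`, `bijective_faltingsTateMap_iff_of_isIsogenous`.
* Over number fields: `faltings_tate_bijective_of_isIsogenous`,
  `faltings_tate_bijective_iff_of_isIsogenous`, `faltings_tate_bijective_of_isIsogenous_of_self`
  (every pair isogenous to `(C, C)` inherits `faltings_tate_bijective C C ℓ` — e.g. from the
  CM-elliptic instance `faltings_tate_bijective_of_CM_elliptic_of_thm18_6`).

## References

* [Faltings1983Endlichkeit] G. Faltings, Invent. Math. 73 (1983), §5, proof of Satz 4 (first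
  sentence) and Korollar 1; English: Cornell–Silverman, *Arithmetic Geometry* (1986), ch. II §5 p. 21.
* [Tate1966Endomorphisms] J. Tate, Invent. Math. 2 (1966), §1 Lemma 1 (torsion-free cokernel).
* [Kieffer2024IsogenyGraphs] J. Kieffer, *Isogeny graphs of abelian varieties over finite fields*
  (2024), Prop. 1.1.12, Prop. 1.2.21.
* [Milne1986AbelianVarieties] J. S. Milne, *Abelian varieties*, in Cornell–Silverman (1986),
  Lemma 12.6, Thm. 12.5.
* [MumfordAV1970] D. Mumford, *Abelian Varieties*, §19 Thm. 3 and Remark p. 169.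
-/

noncomputable section

universe u

open CategoryTheory
open scoped TensorProduct

namespace Literature.AlgebraicGeometry.Motives

namespace AbelianVariety

variable {K : Type u} [Field K] {A A' B B' : AbelianVariety K} (ℓ : ℕ) [Fact ℓ.Prime]

/-! ## Stability of the span of the `T_ℓ f` under composition -/

/-- The `ℤ_ℓ`-span of the `T_ℓ f`, `f ∈ Hom_K(A, B)`, is carried by post-composition with `T_ℓ p`,
`p : B → B'`, into the `ℤ_ℓ`-span of the `T_ℓ h`, `h ∈ Hom_K(A, B')` (`T_ℓ p ∘ T_ℓ f = T_ℓ (f ≫ p)`,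
functoriality `tateModuleMap_comp`). [cite: MumfordAV1970, §19 Thm. 3 (p. 176, functoriality of `T_ℓ`)] -/
theorem comp_mem_span_tateModuleMap_of_mem_span (p : B ⟶ B')
    {g : A.tateModule ℓ →ₗ[ℤ_[ℓ]] B.tateModule ℓ}
    (hg : g ∈ Submodule.span ℤ_[ℓ] (Set.range (tateModuleMap ℓ : (A ⟶ B) → _))) :
    (tateModuleMap ℓ p).comp g ∈
      Submodule.span ℤ_[ℓ] (Set.range (tateModuleMap ℓ : (A ⟶ B') → _)) := by
  induction hg using Submodule.span_induction with
  | mem x hx =>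
    obtain ⟨f, rfl⟩ := hx
    rw [← tateModuleMap_comp]
    exact Submodule.subset_span ⟨f ≫ p, rfl⟩
  | zero => rw [LinearMap.comp_zero]; exact zero_mem _
  | add x y _ _ hx hy => rw [LinearMap.comp_add]; exact add_mem hx hy
  | smul c x _ hx => rw [LinearMap.comp_smul]; exact Submodule.smul_mem _ c hx

/-- The `ℤ_ℓ`-span of the `T_ℓ f`, `f ∈ Hom_K(A, B)`, is carried by pre-composition with `T_ℓ i`,
`i : A' → A`, into the `ℤ_ℓ`-span of the `T_ℓ h`, `h ∈ Hom_K(A', B)` (`T_ℓ f ∘ T_ℓ i = T_ℓ (i ≫ f)`).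
[cite: MumfordAV1970, §19 Thm. 3 (p. 176, functoriality of `T_ℓ`)] -/
theorem mem_span_tateModuleMap_comp_of_mem_span (i : A' ⟶ A)
    {g : A.tateModule ℓ →ₗ[ℤ_[ℓ]] B.tateModule ℓ}
    (hg : g ∈ Submodule.span ℤ_[ℓ] (Set.range (tateModuleMap ℓ : (A ⟶ B) → _))) :
    g.comp (tateModuleMap ℓ i) ∈
      Submodule.span ℤ_[ℓ] (Set.range (tateModuleMap ℓ : (A' ⟶ B) → _)) := by
  induction hg using Submodule.span_induction with
  | mem x hx =>
    obtain ⟨f, rfl⟩ := hx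
    rw [← tateModuleMap_comp]
    exact Submodule.subset_span ⟨i ≫ f, rfl⟩
  | zero => rw [LinearMap.zero_comp]; exact zero_mem _
  | add x y _ _ hx hy => rw [LinearMap.add_comp]; exact add_mem hx hy
  | smul c x _ hx => rw [LinearMap.smul_comp]; exact Submodule.smul_mem _ c hx

/-- `T_ℓ [n] = n`: `T_ℓ (n • 𝟙 A) x = n • x` in `T_ℓ A` (additivity and `T_ℓ 𝟙 = id`; the case
`n = ℓ ^ k` is the tree's `tateModuleMap_pow_smul_id_apply`). [cite: MumfordAV1970, §19 Thm. 3 (p. 176, functoriality of `T_ℓ`)] -/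
theorem tateModuleMap_nsmul_id_apply (n : ℕ) (x : A.tateModule ℓ) :
    tateModuleMap ℓ (n • 𝟙 A) x = (n : ℤ_[ℓ]) • x := by
  rw [tateModuleMap_nsmul, tateModuleMap_id]
  change n • (LinearMap.id (R := ℤ_[ℓ]) x) = _
  rw [LinearMap.id_apply, Nat.cast_smul_eq_nsmul]

/-! ## Saturation for natural multiples -/

/-- **Saturation of the span of the `T_ℓ f` for a natural multiple** (Tate 1966 §1 Lemma 1; Milne
1986 Thm. 12.5 with Lemma 12.6; Kieffer 2024 Prop. 1.2.21): for `ℓ` invertible in `K`, `0 < n`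
and `t : T_ℓ A → T_ℓ B` `ℤ_ℓ`-linear, if `n • t` lies in the `ℤ_ℓ`-span of the `T_ℓ f`,
`f ∈ Hom_K(A, B)`, so does `t` — the tree's `saturated_span_tateModuleMap_of_divisible` at
`d = n ∈ ℤ_ℓ ∖ {0}`, with the divisibility input `exists_eq_nsmul_of_forall_smul_eq_zero`
(a homomorphism killing `A[ℓ](K̄)` is divisible by `ℓ`). [cite: Kieffer2024IsogenyGraphs, Prop. 1.2.21]
[cite: Milne1986AbelianVarieties, Thm. 12.5 with Lemma 12.6 (PDF pp. 190–191)] -/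
theorem mem_span_tateModuleMap_of_nsmul_mem (hℓ : (ℓ : K) ≠ 0) {n : ℕ} (hn : 0 < n)
    (t : A.tateModule ℓ →ₗ[ℤ_[ℓ]] B.tateModule ℓ)
    (ht : (n : ℤ_[ℓ]) • t ∈ Submodule.span ℤ_[ℓ] (Set.range (tateModuleMap ℓ : (A ⟶ B) → _))) :
    t ∈ Submodule.span ℤ_[ℓ] (Set.range (tateModuleMap ℓ : (A ⟶ B) → _)) :=
  saturated_span_tateModuleMap_of_divisible ℓ hℓ
    (fun φ hφ ↦ exists_eq_nsmul_of_forall_smul_eq_zero ℓ hℓ φ hφ) t (n : ℤ_[ℓ])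
    (Nat.cast_ne_zero.mpr hn.ne') ht

/-- Every `Γ_K`-equivariant `g : T_ℓ A → T_ℓ B` lies in the `ℤ_ℓ`-span of the `T_ℓ f` as soon as the
Tate map of `(A, B)` is surjective (`toLinearMap_mem_span_of_mem_range`). [cite: Tate1966Endomorphisms, Main Theorem (span form)] -/
theorem toLinearMap_mem_span_of_surjective (h : Function.Surjective (faltingsTateMap A B ℓ))
    (g : tateHom A B ℓ) :
    g.toLinearMap ∈ Submodule.span ℤ_[ℓ] (Set.range (tateModuleMap ℓ : (A ⟶ B) → _)) :=
  toLinearMap_mem_span_of_mem_range ℓ (LinearMap.mem_range.mpr (h g))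

/-! ## Isogeny invariance of surjectivity / bijectivity of the Tate map -/

/-- **Surjectivity of the Tate map is invariant under an isogeny of the target** ([Faltings 1983,
§5, proof of Satz 4, first sentence]: «one may … replace `A` by an isogenous abelian variety»;
Kieffer 2024 §1.2.4).  For `ℓ` invertible in `K` and an isogeny `φ : B → B'`: if
`ℤ_ℓ ⊗ Hom_K(A, B) → Hom_{Γ_K}(T_ℓ A, T_ℓ B)` is onto, so is `ℤ_ℓ ⊗ Hom_K(A, B') → Hom_{Γ_K}(T_ℓ A, T_ℓ B')`.
With `ψ : B' → B`, `ψ ≫ φ = [n]`, `0 < n`: for `g'` equivariant, `T_ℓ ψ ∘ g'` is a combination of the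
`T_ℓ f`, hence `n • g' = T_ℓ φ ∘ T_ℓ ψ ∘ g'` is a combination of the `T_ℓ (f ≫ φ)`, and the span is
saturated (`mem_span_tateModuleMap_of_nsmul_mem`).
[cite: Faltings1983Endlichkeit, §5, proof of Satz 4, first sentence (Cornell–Silverman ch. II §5 p. 21)]
[cite: MumfordAV1970, §19 Remark p. 169 (quasi-inverse of an isogeny)] -/
theorem surjective_faltingsTateMap_of_isIsogeny_right (hℓ : (ℓ : K) ≠ 0) (φ : B ⟶ B')
    (hφ : IsIsogeny φ) (h : Function.Surjective (faltingsTateMap A B ℓ)) :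
    Function.Surjective (faltingsTateMap A B' ℓ) := by
  obtain ⟨ψ, n, hn, -, hψφ⟩ := IsIsogeny.exists_nsmul_inverse_holds hφ
  refine surjective_faltingsTateMap_of_forall_mem_span ℓ fun g' ↦ ?_
  -- `T_ℓ ψ ∘ g'` is equivariant into `T_ℓ B`, hence in the span for `(A, B)`
  have hg : ((tateIntertwiningMap ℓ ψ).comp g').toLinearMap ∈
      Submodule.span ℤ_[ℓ] (Set.range (tateModuleMap ℓ : (A ⟶ B) → _)) :=
    toLinearMap_mem_span_of_surjective ℓ h _
  -- hence `T_ℓ φ ∘ T_ℓ ψ ∘ g'` is in the span for `(A, B')`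
  have h2 := comp_mem_span_tateModuleMap_of_mem_span ℓ φ hg
  -- and `T_ℓ φ ∘ T_ℓ ψ ∘ g' = n • g'`
  have h3 : (tateModuleMap ℓ φ).comp ((tateIntertwiningMap ℓ ψ).comp g').toLinearMap =
      (n : ℤ_[ℓ]) • g'.toLinearMap := by
    refine LinearMap.ext fun v ↦ ?_
    rw [Representation.IntertwiningMap.comp_toLinearMap, toLinearMap_tateIntertwiningMap,
      LinearMap.comp_apply, LinearMap.comp_apply, ← LinearMap.comp_apply (tateModuleMap ℓ φ),
      ← tateModuleMap_comp, hψφ, tateModuleMap_nsmul_id_apply, LinearMap.smul_apply]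
  rw [h3] at h2
  exact mem_span_tateModuleMap_of_nsmul_mem ℓ hℓ hn _ h2

/-- **Surjectivity of the Tate map is invariant under an isogeny of the source** (same sentence of
[Faltings 1983, §5]).  For `ℓ` invertible in `K` and an isogeny `φ : A → A'`: if
`ℤ_ℓ ⊗ Hom_K(A, B) → Hom_{Γ_K}(T_ℓ A, T_ℓ B)` is onto, so is `ℤ_ℓ ⊗ Hom_K(A', B) → Hom_{Γ_K}(T_ℓ A', T_ℓ B)`:
with `ψ : A' → A`, `ψ ≫ φ = [n]_{A'}`, for `g'` equivariant `g' ∘ T_ℓ φ` is a combination of the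
`T_ℓ f`, hence `n • g' = g' ∘ T_ℓ φ ∘ T_ℓ ψ` is a combination of the `T_ℓ (ψ ≫ f)`; saturation.
[cite: Faltings1983Endlichkeit, §5, proof of Satz 4, first sentence (Cornell–Silverman ch. II §5 p. 21)]
[cite: MumfordAV1970, §19 Remark p. 169 (quasi-inverse of an isogeny)] -/
theorem surjective_faltingsTateMap_of_isIsogeny_left (hℓ : (ℓ : K) ≠ 0) (φ : A ⟶ A')
    (hφ : IsIsogeny φ) (h : Function.Surjective (faltingsTateMap A B ℓ)) :
    Function.Surjective (faltingsTateMap A' B ℓ) := by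
  obtain ⟨ψ, n, hn, -, hψφ⟩ := IsIsogeny.exists_nsmul_inverse_holds hφ
  refine surjective_faltingsTateMap_of_forall_mem_span ℓ fun g' ↦ ?_
  -- `g' ∘ T_ℓ φ` is equivariant on `T_ℓ A`, hence in the span for `(A, B)`
  have hg : (g'.comp (tateIntertwiningMap ℓ φ)).toLinearMap ∈
      Submodule.span ℤ_[ℓ] (Set.range (tateModuleMap ℓ : (A ⟶ B) → _)) :=
    toLinearMap_mem_span_of_surjective ℓ h _
  -- hence `g' ∘ T_ℓ φ ∘ T_ℓ ψ` is in the span for `(A', B)`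
  have h2 := mem_span_tateModuleMap_comp_of_mem_span ℓ ψ hg
  -- and `g' ∘ T_ℓ φ ∘ T_ℓ ψ = n • g'`
  have h3 : (g'.comp (tateIntertwiningMap ℓ φ)).toLinearMap.comp (tateModuleMap ℓ ψ) =
      (n : ℤ_[ℓ]) • g'.toLinearMap := by
    refine LinearMap.ext fun v ↦ ?_
    rw [Representation.IntertwiningMap.comp_toLinearMap, toLinearMap_tateIntertwiningMap,
      LinearMap.comp_apply, LinearMap.comp_apply, ← LinearMap.comp_apply (tateModuleMap ℓ φ),
      ← tateModuleMap_comp, hψφ, tateModuleMap_nsmul_id_apply, map_smul, LinearMap.smul_apply]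
  rw [h3] at h2
  exact mem_span_tateModuleMap_of_nsmul_mem ℓ hℓ hn _ h2

/-- **Bijectivity of the Tate map is invariant under an isogeny of the target**: surjectivity by
`surjective_faltingsTateMap_of_isIsogeny_right`, injectivity for every pair by Mumford §19 Thm. 3
(`faltingsTateMap_injective_holds`). [cite: Faltings1983Endlichkeit, §5, proof of Satz 4, first sentence]
[cite: MumfordAV1970, §19 Thm. 3] -/
theorem bijective_faltingsTateMap_of_isIsogeny_right (hℓ : (ℓ : K) ≠ 0) (φ : B ⟶ B')
    (hφ : IsIsogeny φ) (h : Function.Bijective (faltingsTateMap A B ℓ)) :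
    Function.Bijective (faltingsTateMap A B' ℓ) :=
  ⟨faltingsTateMap_injective_holds A B' ℓ hℓ,
    surjective_faltingsTateMap_of_isIsogeny_right ℓ hℓ φ hφ h.2⟩

/-- **Bijectivity of the Tate map is invariant under an isogeny of the source**: surjectivity by
`surjective_faltingsTateMap_of_isIsogeny_left`, injectivity by Mumford §19 Thm. 3
(`faltingsTateMap_injective_holds`). [cite: Faltings1983Endlichkeit, §5, proof of Satz 4, first sentence]
[cite: MumfordAV1970, §19 Thm. 3] -/
theorem bijective_faltingsTateMap_of_isIsogeny_left (hℓ : (ℓ : K) ≠ 0) (φ : A ⟶ A')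
    (hφ : IsIsogeny φ) (h : Function.Bijective (faltingsTateMap A B ℓ)) :
    Function.Bijective (faltingsTateMap A' B ℓ) :=
  ⟨faltingsTateMap_injective_holds A' B ℓ hℓ,
    surjective_faltingsTateMap_of_isIsogeny_left ℓ hℓ φ hφ h.2⟩

/-- **Surjectivity of the Tate map depends only on the isogeny classes** of `A` and `B` (for `ℓ`
invertible in `K`): `A ∼ A'`, `B ∼ B'` and surjectivity for `(A, B)` give surjectivity for `(A', B')`.
[cite: Faltings1983Endlichkeit, §5, proof of Satz 4, first sentence (Cornell–Silverman ch. II §5 p. 21)] -/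
theorem surjective_faltingsTateMap_of_isIsogenous (hℓ : (ℓ : K) ≠ 0) (hA : IsIsogenous A A')
    (hB : IsIsogenous B B') (h : Function.Surjective (faltingsTateMap A B ℓ)) :
    Function.Surjective (faltingsTateMap A' B' ℓ) := by
  obtain ⟨φ, hφ⟩ := hA
  obtain ⟨ψ, hψ⟩ := hB
  exact surjective_faltingsTateMap_of_isIsogeny_right ℓ hℓ ψ hψ
    (surjective_faltingsTateMap_of_isIsogeny_left ℓ hℓ φ hφ h)

/-- **Bijectivity of the Tate map depends only on the isogeny classes** of `A` and `B` (for `ℓ`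
invertible in `K`). [cite: Faltings1983Endlichkeit, §5, proof of Satz 4, first sentence (Cornell–Silverman ch. II §5 p. 21)]
[cite: MumfordAV1970, §19 Thm. 3] -/
theorem bijective_faltingsTateMap_of_isIsogenous (hℓ : (ℓ : K) ≠ 0) (hA : IsIsogenous A A')
    (hB : IsIsogenous B B') (h : Function.Bijective (faltingsTateMap A B ℓ)) :
    Function.Bijective (faltingsTateMap A' B' ℓ) :=
  ⟨faltingsTateMap_injective_holds A' B' ℓ hℓ,
    surjective_faltingsTateMap_of_isIsogenous ℓ hℓ hA hB h.2⟩

/-- **Bijectivity of the Tate map is the same for isogenous pairs** (`↔`; the converse direction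
through the symmetry of isogeny, `IsIsogenous.symm'`). [cite: Faltings1983Endlichkeit, §5, proof of Satz 4, first sentence (Cornell–Silverman ch. II §5 p. 21)] -/
theorem bijective_faltingsTateMap_iff_of_isIsogenous (hℓ : (ℓ : K) ≠ 0) (hA : IsIsogenous A A')
    (hB : IsIsogenous B B') :
    Function.Bijective (faltingsTateMap A B ℓ) ↔ Function.Bijective (faltingsTateMap A' B' ℓ) :=
  ⟨bijective_faltingsTateMap_of_isIsogenous ℓ hℓ hA hB,
    bijective_faltingsTateMap_of_isIsogenous ℓ hℓ hA.symm' hB.symm'⟩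

end AbelianVariety

/-! ## Over number fields: `faltings_tate_bijective` is an invariant of the isogeny classes -/

section NumberField

open AbelianVariety

variable {K : Type u} [Field K] {A A' B B' C : AbelianVariety K} (ℓ : ℕ) [Fact ℓ.Prime]

/-- **[Fal83 §5 Kor. 1] is an invariant of the `K`-isogeny classes** (first sentence of the proof
of Satz 4: «one may … replace `A` by an isogenous abelian variety», here kernel-checked for the
integral `Hom` statement): over a number field, `A ∼ A'` and `B ∼ B'` carry
`faltings_tate_bijective A B ℓ` to `faltings_tate_bijective A' B' ℓ` (`char K = 0`, so `ℓ` is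
invertible: `natCast_ne_zero_of_numberField`).
[cite: Faltings1983Endlichkeit, §5, proof of Satz 4, first sentence, and Korollar 1 (Cornell–Silverman ch. II §5 p. 21)] -/
theorem faltings_tate_bijective_of_isIsogenous (hA : IsIsogenous A A') (hB : IsIsogenous B B')
    (h : faltings_tate_bijective A B ℓ) : faltings_tate_bijective A' B' ℓ :=
  fun {_} ↦ bijective_faltingsTateMap_of_isIsogenous ℓ (natCast_ne_zero_of_numberField ℓ) hA hB h

/-- `faltings_tate_bijective` agrees on isogenous pairs (`↔`).
[cite: Faltings1983Endlichkeit, §5, proof of Satz 4, first sentence, and Korollar 1 (Cornell–Silverman ch. II §5 p. 21)] -/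
theorem faltings_tate_bijective_iff_of_isIsogenous (hA : IsIsogenous A A') (hB : IsIsogenous B B') :
    faltings_tate_bijective A B ℓ ↔ faltings_tate_bijective A' B' ℓ :=
  ⟨faltings_tate_bijective_of_isIsogenous ℓ hA hB,
    faltings_tate_bijective_of_isIsogenous ℓ hA.symm' hB.symm'⟩

/-- **Every pair isogenous to `(C, C)` inherits the `End` case**: if `ℤ_ℓ ⊗ End_K(C) → End_{Γ_K}(T_ℓ C)`
is bijective over a number field ([Fal83 §5 Satz 4] at `C`) and `A ∼ C`, `B ∼ C`, then
`faltings_tate_bijective A B ℓ` ([Fal83 §5 Kor. 1] at `(A, B)`).  With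
`faltings_tate_bijective_of_CM_elliptic_of_thm18_6` (the tree's CM-elliptic instance at `(A₀, A₀)`)
this decides Kor. 1 for every pair of abelian varieties `K`-isogenous to one CM elliptic structure.
[cite: Faltings1983Endlichkeit, §5, proof of Satz 4, first sentence, and Korollar 1 (Cornell–Silverman ch. II §5 p. 21)] -/
theorem faltings_tate_bijective_of_isIsogenous_of_self (hA : IsIsogenous C A) (hB : IsIsogenous C B)
    (h : faltings_tate_bijective C C ℓ) : faltings_tate_bijective A B ℓ :=
  faltings_tate_bijective_of_isIsogenous ℓ hA hB h

end NumberField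

end Literature.AlgebraicGeometry.Motives

end
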